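import Literature.NumberTheory.EllipticCurves.BSDSelmerPConverseRankZeroOrdinaryProofs
import Literature.NumberTheory.EllipticCurves.PAdicBSD
import HarnessLib

/-!
# Skinner–Urban 2014, Thm. 3.6.11 (b): `L(E, 1) = 0 ⟹ corank_{ℤ_p} Sel_{p^∞}(E/ℚ) ≥ 1`, PROVED
# below the main conjecture bsd.S21 (`skinner_urban_main_conjecture`) and modularity — for `p ≥ 3`

C. Skinner, E. Urban, *The Iwasawa main conjectures for `GL₂`*, Invent. Math. 195 (2014), 1–277
(bib key `SkinnerUrban2014`; held author version `paper:doi-10-1007-s00222-013-0448-1`, pages and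
three-level numbering of that text, as everywhere in the tree).

**Theorem 3.6.11, as printed** (p. 46, ll. 9–24; = Theorem 2 of the Introduction, p. 3): "Let `E`
be an elliptic curve over `ℚ` with conductor `N_E`. Suppose • `E` has good ordinary reduction at
`p`; • there exists a prime `q ‖ N_E`, `q ≠ p`, such that `ρ̄_{E,p}` is ramified at `q`;
• `ρ̄_{E,p}` is irreducible. (a) If `L(E, 1) ≠ 0` and `ρ̄_{E,p}` is surjective then
`|L(E,1)/Ω_E|_p⁻¹ = #Ш(E/ℚ)_p · ∏_{ℓ ∣ N_E} c_ℓ(E)`. (b) If `L(E, 1) = 0` then the corank of the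
Selmer group `Sel_{p^∞}(E/ℚ)` is at least one. *Proof.* This follows from the equality
`(L_f) = (L_E) = F_E`, the interpolation properties of `L_f` and `L_E`, and Theorem 4.1 of
[Gr99]." (`p` is an odd prime throughout the paper, §1.1, p. 1.)

Part (a) is the tree's named fact bsd.S30 `padicValRat_bsd_rank_zero` (file `LeadingTerm`), proved
below bsd.S21 in `LeadingTermPPartProofs` (`padicValRat_bsd_rank_zero_of_mainConjecture`). This
file PROVES part **(b)** the printed way, below the tree's named fact bsd.S21
`skinner_urban_main_conjecture` (= Thm. 3.6.9, p. 45, the main conjecture "`F_E = (L_E)` in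
`Λ_ℚ ⊗_{ℤ_p} ℚ_p`"; only its RATIONAL clause (2) is used, so NO surjectivity hypothesis enters —
exactly as printed, (b) carries none) and modularity in its existence form `exists_isNewformOf`:

* the main conjecture gives `char_Λ X(E/ℚ_∞) = (g)` with `ι g = p^k · L_p(E, T)`, `k ∈ ℤ`;
* "Theorem 4.1 of [Gr99]" in its qualitative form — `Sel_{p^∞}(E/ℚ)` finite ⟹ `g(0) ≠ 0` — is the
  tree THEOREM `constantCoeff_charGenerator_ne_zero_of_finite_selmerGroupPInfty`
  (`BSDSelmerPConverseRankZeroOrdinaryProofs`, from Greenberg's Lemmas 3.3–3.5 at the layer `n = 0`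
  and the control computation, valid at every ODD good ordinary `p`);
* "the interpolation properties": `L_p(E, 0) = (1 - α⁻¹)² [0]⁺_f` (tree theorem
  `constantCoeff_padicLFunction_unitRoot`, Mazur–Tate–Teitelbaum §I.14) and `L(E, 1) = [0]⁺_f · Ω⁺_f`
  with `Ω⁺_f > 0` (`IsNewformOf.entireLFunction_one_eq`, `IsNewform0.plusPeriod_pos_holds`);

whence `Sel_{p^∞}(E/ℚ)` finite ⟹ `L(E, 1) ≠ 0`, i.e. (b) by contraposition, "corank at least one"
being "`Sel_{p^∞}(E/ℚ)` infinite" for the cofinitely generated `ℤ_p`-module `Sel_{p^∞}(E/ℚ) ≅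
(ℚ_p/ℤ_p)^s ⊕ (finite)` (`finite_selmerGroupPInfty_iff_selmerCorank_eq_zero`).

What is new relative to the tree: the sibling theorems of `BSDSelmerPConverseRankZeroOrdinaryProofs`
(`one_le_selmerCorank_of_entireLFunction_one_eq_zero_of_mazurMainConjecture` etc.) take the main
conjecture from Burungale–Castella–Skinner 2025, Thm. 1.1.2 (a), hence `p ≥ 5` and no auxiliary
prime; the present Skinner–Urban form holds for every `p ≥ 3` — in particular at **`p = 3`** — at
the price of S–U's hypothesis (ram)/(mult) "a prime `q ‖ N_E`, `q ≠ p`, with `ρ̄_{E,p}` ramified at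
`q`" (transcribed through Tate's parametrisation as in bsd.S21/bsd.S30: multiplicative reduction at
`q` and `p ∤ v_q(Δ_min)`; = `Rank1Residual.Ram`). The proof is the same thirty lines with the other
named fact. Theorems only (no `def`, no named fact; D-0014/D-0026): the two deep inputs are the
EXISTING facts `skinner_urban_main_conjecture` (`hSU`, quantified over all its parameters exactly
as in `LeadingTermPPartProofs.padicValRat_bsd_rank_zero_of_mainConjecture`) and
`exists_isNewformOf` (`hmod`).

## References

* C. Skinner, E. Urban, Invent. Math. 195 (2014): §1.1 (p. 1), Thm. 2 (p. 3), §3.6.7 and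
  Thm. 3.6.9 (p. 45), Thm. 3.6.11 and its proof, Remark (b) (p. 46). [SkinnerUrban2014]
* R. Greenberg, *Iwasawa theory for elliptic curves*, LNM 1716 (1999), Thm. 4.1 (p. 102), §3
  Lemmas 3.3–3.5, §1 pp. 65–66. [GreenbergLNM1716]
* B. Mazur, J. Tate, J. Teitelbaum, Invent. Math. 84 (1986), §I.14. [MazurTateTeitelbaum1986]
-/

noncomputable section

open scoped MatrixGroups ModularForm

open CongruenceSubgroup WeierstrassCurve Literature.NumberTheory.EllipticCurves.ModularForms

namespace Literature.NumberTheory.EllipticCurves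

namespace SkinnerUrban2014

/-- **`Sel_{p^∞}(E/ℚ)` finite ⟹ `L(E, 1) ≠ 0`, below bsd.S21 and modularity** (the contrapositive
of Skinner–Urban Thm. 3.6.11 (b), by the printed proof: main conjecture in `Λ ⊗ ℚ_p`, Greenberg's
Thm. 4.1, interpolation). Hypotheses: `W` a globally minimal model of `E/ℚ`, `p ≥ 3` of good
ordinary reduction (`hgood`, `hord`), `E[p]` irreducible (`hirr`), and S–U's (ram): a prime
`ℓ ≠ p` of multiplicative reduction with `p ∤ v_ℓ(Δ_min)` (`haux`, the binder of bsd.S21 verbatim).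
[cite: SkinnerUrban2014, Thm. 3.6.11 (b) and its proof (p. 46)]
[cite: GreenbergLNM1716, Thm. 4.1 (p. 102)] -/
theorem entireLFunction_one_ne_zero_of_finite_selmerGroupPInfty_of_mainConjecture
    (hmod : exists_isNewformOf)
    (hSU : ∀ (W : WeierstrassCurve ℚ) [W.IsElliptic] [W.IsGloballyMinimal] (p : ℕ) [Fact p.Prime]
      (κ : ZpExtension ℚ p) (γ : Field.absoluteGaloisGroup ℚ) (N : ℕ) [NeZero N]
      (f : CuspForm (Gamma0 N) 2),
      skinner_urban_main_conjecture W p (κ := κ) (γ := γ) (f := f))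
    (W : WeierstrassCurve ℚ) [W.IsElliptic] [W.IsGloballyMinimal] (p : ℕ) [Fact p.Prime]
    (hp : 3 ≤ p) (hgood : W.HasGoodReductionAtPrime p) (hord : ¬ (p : ℤ) ∣ W.frobeniusTrace p)
    (hirr : W.HasIrreducibleModPGaloisRep p)
    (haux : ∃ ℓ : ℕ, ∃ _ : Fact ℓ.Prime, ℓ ≠ p ∧ W.HasMultiplicativeReductionAtPrime ℓ ∧
      ¬ p ∣ padicValInt ℓ W.minimalDiscriminantInt)
    (hSel : Finite (W.selmerGroupPInfty p)) :
    W.entireLFunction 1 ≠ 0 := by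
  have hordp : IsOrdinaryAt W p := ⟨hgood, hord⟩
  -- modularity: the newform `f` of `E`
  haveI : NeZero (W.conductorNorm ℤ) := ⟨(W.conductorNorm_pos_holds).ne'⟩
  obtain ⟨f, hf⟩ := hmod W
  -- the cyclotomic setting and the Iwasawa module `X = X(E/ℚ_∞)`
  obtain ⟨κ, hκ, γ, hγ, hγ'⟩ := exists_isCyclotomic_isTopGenerator_isCyclotomicVariable_holds p
  obtain ⟨D⟩ := W.nonempty_selmerDualData_holds κ γ hγ
  -- (1) Skinner–Urban Thm. 3.6.9, clause (2): `char X = (g)`, `ι g = p^k · L_p(E, T)` (`k ∈ ℤ`)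
  obtain ⟨-, ⟨g, k, hchar, hιg⟩, -⟩ :=
    hSU W p κ γ (W.conductorNorm ℤ) f hp hgood hord hirr haux hκ hγ hγ' hf D
  -- (2) Greenberg's Thm. 4.1: `g(0) ≠ 0`
  have hg0 : PowerSeries.constantCoeff g ≠ 0 :=
    constantCoeff_charGenerator_ne_zero_of_finite_selmerGroupPInfty W p (by omega) hgood hord κ γ
      hκ hγ D g hchar hSel
  -- (3) interpolation: `g(0) = p^k · (1 - α⁻¹)² · [0]⁺_f`, so `[0]⁺_f ≠ 0`
  have hc : ((PowerSeries.constantCoeff g : ℤ_[p]) : ℚ_[p]) =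
      (p : ℚ_[p]) ^ k * ((1 - (unitRoot W p : ℚ_[p])⁻¹) ^ 2 * ((ratPlusSymbol f 0 : ℚ) : ℚ_[p])) := by
    rw [← constantCoeff_iwasawaToPowerSeries p g, hιg, map_mul, PowerSeries.constantCoeff_C,
      constantCoeff_padicLFunction_unitRoot hordp hf]
  have hs0 : (ratPlusSymbol f 0 : ℚ) ≠ 0 := by
    intro h0
    apply hg0
    have h : ((PowerSeries.constantCoeff g : ℤ_[p]) : ℚ_[p]) = 0 := by
      rw [hc, h0]
      simp
    exact PadicInt.coe_eq_zero.1 h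
  -- (4) `L(E, 1) = [0]⁺_f · Ω⁺_f` with `Ω⁺_f > 0`
  have hpos : 0 < plusPeriod f := IsNewform0.plusPeriod_pos_holds hf.1 hf.coeffField_eq_bot
  rw [hf.entireLFunction_one_eq, Complex.ofReal_ne_zero]
  exact mul_ne_zero (by exact_mod_cast hs0) hpos.ne'

/-- **Skinner–Urban 2014, Thm. 3.6.11 (b)** ("If `L(E, 1) = 0` then the corank of the Selmer
group `Sel_{p^∞}(E/ℚ)` is at least one"), PROVED below bsd.S21 `skinner_urban_main_conjecture` and
modularity `exists_isNewformOf`, for `E/ℚ` (globally minimal `W`), `p ≥ 3` good ordinary, `E[p]`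
irreducible and a prime `ℓ ≠ p` of multiplicative reduction with `p ∤ v_ℓ(Δ_min)` (S–U's `q ‖ N_E`
with `ρ̄_{E,p}` ramified at `q`). New at `p = 3` (the Burungale–Castella–Skinner form of the sibling
file needs `p ≥ 5`). [cite: SkinnerUrban2014, Thm. 3.6.11 (b) (p. 46) = Thm. 2 (b) (p. 3)] -/
theorem thm3611b_one_le_selmerCorank_of_entireLFunction_one_eq_zero
    (hmod : exists_isNewformOf)
    (hSU : ∀ (W : WeierstrassCurve ℚ) [W.IsElliptic] [W.IsGloballyMinimal] (p : ℕ) [Fact p.Prime]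
      (κ : ZpExtension ℚ p) (γ : Field.absoluteGaloisGroup ℚ) (N : ℕ) [NeZero N]
      (f : CuspForm (Gamma0 N) 2),
      skinner_urban_main_conjecture W p (κ := κ) (γ := γ) (f := f))
    (W : WeierstrassCurve ℚ) [W.IsElliptic] [W.IsGloballyMinimal] (p : ℕ) [Fact p.Prime]
    (hp : 3 ≤ p) (hgood : W.HasGoodReductionAtPrime p) (hord : ¬ (p : ℤ) ∣ W.frobeniusTrace p)
    (hirr : W.HasIrreducibleModPGaloisRep p)
    (haux : ∃ ℓ : ℕ, ∃ _ : Fact ℓ.Prime, ℓ ≠ p ∧ W.HasMultiplicativeReductionAtPrime ℓ ∧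
      ¬ p ∣ padicValInt ℓ W.minimalDiscriminantInt)
    (hL : W.entireLFunction 1 = 0) :
    1 ≤ W.selmerCorank p := by
  by_contra h
  have h0 : W.selmerCorank p = 0 := by omega
  exact entireLFunction_one_ne_zero_of_finite_selmerGroupPInfty_of_mainConjecture hmod hSU W p hp
    hgood hord hirr haux ((finite_selmerGroupPInfty_iff_selmerCorank_eq_zero W p).2 h0) hL

/-- **Corank form of Thm. 3.6.11 (b)** (the rank-zero `p`-converse below bsd.S21, `p ≥ 3`):
`corank_{ℤ_p} Sel_{p^∞}(E/ℚ) = 0 ⟹ ord_{s=1} L(E, s) = 0`, under the hypotheses of Thm. 3.6.11.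
[cite: SkinnerUrban2014, Thm. 3.6.11 (b) (p. 46)] -/
theorem analyticRank_eq_zero_of_selmerCorank_eq_zero_of_mainConjecture
    (hmod : exists_isNewformOf)
    (hSU : ∀ (W : WeierstrassCurve ℚ) [W.IsElliptic] [W.IsGloballyMinimal] (p : ℕ) [Fact p.Prime]
      (κ : ZpExtension ℚ p) (γ : Field.absoluteGaloisGroup ℚ) (N : ℕ) [NeZero N]
      (f : CuspForm (Gamma0 N) 2),
      skinner_urban_main_conjecture W p (κ := κ) (γ := γ) (f := f))
    (W : WeierstrassCurve ℚ) [W.IsElliptic] [W.IsGloballyMinimal] (p : ℕ) [Fact p.Prime]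
    (hp : 3 ≤ p) (hgood : W.HasGoodReductionAtPrime p) (hord : ¬ (p : ℤ) ∣ W.frobeniusTrace p)
    (hirr : W.HasIrreducibleModPGaloisRep p)
    (haux : ∃ ℓ : ℕ, ∃ _ : Fact ℓ.Prime, ℓ ≠ p ∧ W.HasMultiplicativeReductionAtPrime ℓ ∧
      ¬ p ∣ padicValInt ℓ W.minimalDiscriminantInt)
    (h0 : W.selmerCorank p = 0) :
    W.analyticRank = 0 :=
  analyticRank_eq_zero_of_entireLFunction_one_ne_zero W
    (entireLFunction_one_ne_zero_of_finite_selmerGroupPInfty_of_mainConjecture hmod hSU W p hp hgood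
      hord hirr haux ((finite_selmerGroupPInfty_iff_selmerCorank_eq_zero W p).2 h0))

/-- **Skinner–Urban 2014, Remark (b) after Thm. 3.6.11 (p. 46): with the sign of the functional
equation equal to `+1`, the corank is at least two.** As printed: "If the sign of the functional
equation of `L(E, s)` is `−1` (i.e., if the order of vanishing at `s = 1` is odd) then the positivity
of the corank of `Sel_{p^∞}(E/ℚ)` has been established without assuming the existence of the prime
`q` or the irreducibility of `ρ̄_{E,p}` (see [Ne01] and [SU06]). However, the conclusion of (b) is
new for the case when the sign is `+1`, in which case it can be strengthened in combination with
[Ne01, Thm. A] to conclude that the corank is at least two." PROVED below bsd.S21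
(`skinner_urban_main_conjecture`), modularity (`exists_isNewformOf`) and the `p`-parity theorem in
the tree's form bsd.S19 `p_parity W p` (`(-1)^{corank} = w(E)`; S–U's "[Ne01, Thm. A]" is Nekovář's
parity theorem at a good ordinary `p`, the tree's named fact cites Dokchitser–Dokchitser 2010,
Thm. 1.4, for every `p`): under the hypotheses of Thm. 3.6.11, `L(E, 1) = 0` and `w(E) = +1` give
`corank ≥ 1` by (b) and `corank` even by parity, hence `corank_{ℤ_p} Sel_{p^∞}(E/ℚ) ≥ 2`.
[cite: SkinnerUrban2014, Thm. 3.6.11, Remark (b) (p. 46)]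
[cite: DokchitserDokchitserAnnals2010, Thm. 1.4] -/
theorem remark3611b_two_le_selmerCorank_of_rootNumber_eq_one
    (hmod : exists_isNewformOf)
    (hSU : ∀ (W : WeierstrassCurve ℚ) [W.IsElliptic] [W.IsGloballyMinimal] (p : ℕ) [Fact p.Prime]
      (κ : ZpExtension ℚ p) (γ : Field.absoluteGaloisGroup ℚ) (N : ℕ) [NeZero N]
      (f : CuspForm (Gamma0 N) 2),
      skinner_urban_main_conjecture W p (κ := κ) (γ := γ) (f := f))
    (W : WeierstrassCurve ℚ) [W.IsElliptic] [W.IsGloballyMinimal] (p : ℕ) [Fact p.Prime]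
    (hpar : p_parity W p)
    (hp : 3 ≤ p) (hgood : W.HasGoodReductionAtPrime p) (hord : ¬ (p : ℤ) ∣ W.frobeniusTrace p)
    (hirr : W.HasIrreducibleModPGaloisRep p)
    (haux : ∃ ℓ : ℕ, ∃ _ : Fact ℓ.Prime, ℓ ≠ p ∧ W.HasMultiplicativeReductionAtPrime ℓ ∧
      ¬ p ∣ padicValInt ℓ W.minimalDiscriminantInt)
    (hL : W.entireLFunction 1 = 0) (hsign : W.rootNumber = 1) :
    2 ≤ W.selmerCorank p := by
  have h1 : 1 ≤ W.selmerCorank p :=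
    thm3611b_one_le_selmerCorank_of_entireLFunction_one_eq_zero hmod hSU W p hp hgood hord hirr
      haux hL
  have heven : Even (W.selmerCorank p) := by
    have h : (-1 : ℤ) ^ W.selmerCorank p = 1 := by
      have h' : (-1 : ℤ) ^ W.selmerCorank p = W.rootNumber := hpar
      rw [h', hsign]
    exact (neg_one_pow_eq_one_iff_even (by norm_num)).1 h
  obtain ⟨m, hm⟩ := heven
  omega

end SkinnerUrban2014

end Literature.NumberTheory.EllipticCurves

end
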